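import Summits.QuantumFields.YangMills.Theorems.BalabanUVNodesN19TargetAtRecord13CoPH
import Summits.QuantumFields.YangMills.Theorems.BalabanUVNodesN19MGFFormAtRecordMass

/-!
# BalabanUVNodes ∕ N19 (NE7) — node U5's :183 road (∃δ-EDGE FORM) FOR TERM DATA READ OFF NODE 00's DRESSED CLASS WEIGHTS, WITH THE EXTRACTION IDENTITIES
# E1 ∕ E2 DISCHARGED (module B′ `…N19MGFFormAtRecordMass`, p549768 ∕ p551256): two displayed hypotheses of N19's datum-level face
# `matching_scheme_of_coreEdge` ∕ `matching_datumOfRecord₁₃CoPH_of_coreEdge` become theorems when run A's term weights ARE F3's class weights and run B's are their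
# fibre sums along a truncation map

Cell `pub-ymgap` (HUMAN RULING D-0062, Track A), R134 seat `pub-ymgap-dag-n19-d` (gen 9), strategy s2 «by-name knit»; lane = dag-lead g11 LANE WORD l.21525 (the MGF road's
AT-RECORD seat).  Filed `--kind proof --supports stmt-QuantumFields-20544 --as helper` (K3⁷ `SpineGivenEndpointR13SepCoPH`); COUNT-NEUTRAL.  [III] = [Balaban1988Convergent],
[IV] = [Balaban1989LargeFieldI].

WHAT.  N19's world-free face (module 1 `…N19TargetAtRecord11.matching_scheme_of_coreEdge`, its ₁₃ instances `matching_datumOfRecord₁₃{,Sep,Co,CoP,CoPR,CoPH}_of_coreEdge`)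
reads, for abstract term data `(T, A, B, shA, shB, Bad, W, Wsh)` over one index type `ι`: `0 ≤ l₀`, `0 < vol`, N20's `RelWeightBound`, N21's `ShellWeightBound`, U4′'s
`W + Wsh < 1`, N19's ∃δ-edge, AND the two EXTRACTION IDENTITIES `hE1 : schemeZ … (K₀+K) t = Σ_{τ ∈ T K} A K t τ`, `hE2 : schemeZ … (K₀+K+1) t = Σ_{τ ∈ T K} B K t τ`, and
concludes `∃ δ′, Summable δ′ ∧ MatchingModConstants vol l₀ δ′ (schemeZ …)`.  HERE the term data are READ OFF F3: index type `ι := Σ K, SeqOfRecord` (run A's sequences of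
record at cutoff `(pA K).K = K₀ + K`, full length), `T K := univ ↪ Σ` (`Function.Embedding.sigmaMk K`), `A K t ⟨K', s⟩ := classWeightOfDatum₉ ϑ D g₀ os (pA K') (gA K') (pA K').K t s`,
`B K t ⟨K', s⟩ := Σ_{s' : tr K' s' = s} classWeightOfDatum₉ ϑ D g₀ os (pB K') (gB K') (pB K').K t s'` (run B at cutoff `K₀ + K + 1`, summed over the fibre of ANY truncation
map `tr K` into run A's sequences — node U5d's object, a PARAMETER here); then `hE1` ∕ `hE2` are module B′'s ★★ `sum_classWeightOfDatum₉_eq_schemeZ_of_ppSelLive(_of_localBg)`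
∕ `sum_fiberwise_…` at the tuple's LIVE selector pin (`Finset.sum_map`, `Finset.sum_fiberwise_of_maps_to`), for runs whose coupling history starts at the dressing's
coupling (`gA K 0 = g₀ (pA K).K`, `gB K 0 = g₀ (pB K).K`).  The shells `shA ∕ shB`, bad sets, weights `W ∕ Wsh` and the ∃δ-edge stay ABSTRACT hypotheses (they are
the reading's and nodes N20 ∕ N21 ∕ N19's).  Decidability instances in the statements are the classical ones (`open Classical`), as a reading's `dec` field would supply.
* §1 ANY DATUM `D` with `D.AvgMeasurable`, any Stage-9 tuple at the live selector, laws from the rows ((H-U), (H-ζ), `0 ≤ ζ`, `IsZetaAbsLeOne`, `IsZetaUnity`):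
  `schemeZ_eq_sum_classWeights_sigma` (E1 in the face's shape) · `schemeZ_succ_eq_sum_fiber_classWeights_sigma` (E2 in the face's shape) ·
  ★ `matching_scheme_of_coreEdge_classWeights` (the :183 road with `hE1`∕`hE2` DISCHARGED).
* §2 AT NODE 00's v1.7 DATUM `datumOfRecord₁₃CoPH F N θ h` (`θ : Stage13HParams`; rows `h.zetaAbs`∕`h.zetaUnity`, B1 BY NAME): ★ `matching_datumOfRecord₁₃CoPH_of_coreEdge_classWeights`.

HONEST FRAMING — what this is NOT.  [folklore ∕ bookkeeping]: a by-name composition of module 1's face with module B′'s identities; NO estimate (NE7 ∕ NE7b ∕ NE7c NOT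
PRINTED for d = 4, NOT proved; the ∃δ-edge, `RelWeightBound`, `ShellWeightBound`, `W + Wsh < 1` remain HYPOTHESES); it does NOT build the Summits-side spine-carrier reading
(shells, bad sets, the truncation map are parameters); nothing of Bałaban's asserted; no `Provisos₁₃CoPH` inhabitant claimed (K0⁷ open); N19 NOT discharged (0∕1); K3⁷ NOT
claimed; counts UNMOVED (typed 28∕28 · discharged 5∕27, A 5∕28).  One finite four-torus programme at fixed `ε` — NOT ℝ⁴, NOT infinite volume, NOT OS, NOT a mass gap, NOT
the Clay problem.  No `sorry`, no `axiom`, no `instance`, no `notation`, no `def` (theorems only).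
-/

noncomputable section

namespace Summit.QuantumFields.YangMills.BalabanUVNodes.N19TargetClassWeightsE1

open MeasureTheory
open scoped BigOperators Matrix.Norms.L2Operator
open Literature.MathematicalPhysics.QuantumFieldTheory.Balaban1983to89
open Literature.MathematicalPhysics.QuantumFieldTheory.Balaban1983to89.Node00
open T4Continuum B14.Eq218Concrete
open T4WeightBudget (RelWeightBound)
open T4IndicatorShell (ShellWeightBound)
open T4CauchySum (MatchingModConstants)
open Summit.QuantumFields.BalabanUV.T4Continuum.Spine
open Summit.QuantumFields.YangMills.BalabanUVNodes.N19TargetAtRecord11 (matching_scheme_of_coreEdge)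
open Summit.QuantumFields.YangMills.BalabanUVNodes.N19MGFFormAtRecord (wOfRecord₉_nonneg wOfRecord₉_le_one)
open Summit.QuantumFields.YangMills.BalabanUVNodes.N19MGFFormAtRecordMass

variable {F : T4Family} {N : ℕ} [NeZero N]

/-! ## §1 Any datum with measurable averaging: E1 ∕ E2 in the face's shape, and the :183 road with them discharged -/

section AnyDatum

variable (ϑ : Stage9Params F N) (E : B12.RunParams → ℝ)

/-- **E1 IN THE SHAPE OF THE FACE** (`Σ`-indexed run-A classes, term weight = F3's class weight of the indexed run at full length): for every `K`, every source `t`,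
`schemeZ (D.scheme g₀) os (K₀ + K) t = Σ_{x ∈ univ ↪ Σ (at K)} classWeightOfDatum₉ ϑ D g₀ os (pA x.1) (gA x.1) (pA x.1).K t x.2` — `Finset.sum_map` then module B′ ★★ at
`k = (pA K).K`. The bound `|t| ≤ l₀` of the face is not needed and not read. [cite: Balaban1985UV3, (6) p.257; King1986, (3.10) p.656 (bookkeeping)] -/
theorem schemeZ_eq_sum_classWeights_sigma (hsel : ϑ.ppSel = ppSelLiveOfRecord F N ϑ.ν ϑ.τ9 E (wOfRecord₉ F N ϑ))
    (hU : LocalBgMeasurable F N ϑ.ν) (hζm : ZetaMeasurable F N ϑ.ζ) (hζ0 : ∀ p g k s Pl Ql RS U V', 0 ≤ ϑ.ζ p g k s Pl Ql RS U V')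
    (hζ1 : IsZetaAbsLeOne F N ϑ.ν ϑ.τ9.M ϑ.ζ) (hζu : IsZetaUnity F N ϑ.ν ϑ.τ9.M ϑ.ζ)
    (D : FiniteEpsData F (SU N)) (hD : D.AvgMeasurable) (g₀ : ℕ → ℝ) (os : List (ULoop F)) {K₀ : ℕ} (pA : ℕ → B12.RunParams) (gA : ℕ → ℕ → ℝ)
    (hKA : ∀ K, (pA K).K = K₀ + K) (hgA : ∀ K, gA K 0 = g₀ (pA K).K) (l₀ : ℝ) :
    ∀ (K : ℕ) (t : ℝ), |t| ≤ l₀ →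
      T4GenFunBounds.schemeZ (D.scheme g₀) os (K₀ + K) t =
        ∑ x ∈ (Finset.univ : Finset (SeqOfRecord F ϑ.ν ϑ.τ9.M (gA K) (pA K).K (pA K).K)).map (Function.Embedding.sigmaMk (β := fun K' => SeqOfRecord F ϑ.ν ϑ.τ9.M (gA K') (pA K').K (pA K').K) K),
          classWeightOfDatum₉ F N ϑ D g₀ os (pA x.1) (gA x.1) (pA x.1).K t x.2 := by
  intro K t _
  rw [Finset.sum_map, ← hKA K]
  exact (sum_classWeightOfDatum₉_eq_schemeZ_of_ppSelLive_of_localBg ϑ E hsel (hgA K) hU hζm hζ0 hζ1 hζu D hD os t (pA K).K le_rfl).symm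

open Classical in
/-- **E2 IN THE SHAPE OF THE FACE**: run B's term weight on the class `x = ⟨K, s⟩` := the sum of run B's class weights (cutoff `(pB K).K = K₀ + K + 1`, full length) over the fibre
`{s' : tr K s' = s}` of the truncation map; summed over the classes it gives `schemeZ (D.scheme g₀) os (K₀ + K + 1) t` — module B′ §5 (`Finset.sum_fiberwise_of_maps_to`).
[cite: Balaban1985UV3, (6) p.257; King1986, (3.10) p.656; Balaban1988Convergent, (2.18) p.257 (bookkeeping)] -/
theorem schemeZ_succ_eq_sum_fiber_classWeights_sigma (hsel : ϑ.ppSel = ppSelLiveOfRecord F N ϑ.ν ϑ.τ9 E (wOfRecord₉ F N ϑ))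
    (hU : LocalBgMeasurable F N ϑ.ν) (hζm : ZetaMeasurable F N ϑ.ζ) (hζ0 : ∀ p g k s Pl Ql RS U V', 0 ≤ ϑ.ζ p g k s Pl Ql RS U V')
    (hζ1 : IsZetaAbsLeOne F N ϑ.ν ϑ.τ9.M ϑ.ζ) (hζu : IsZetaUnity F N ϑ.ν ϑ.τ9.M ϑ.ζ)
    (D : FiniteEpsData F (SU N)) (hD : D.AvgMeasurable) (g₀ : ℕ → ℝ) (os : List (ULoop F)) {K₀ : ℕ} (pA pB : ℕ → B12.RunParams) (gA gB : ℕ → ℕ → ℝ)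
    (hKB : ∀ K, (pB K).K = K₀ + K + 1) (hgB : ∀ K, gB K 0 = g₀ (pB K).K)
    (tr : (K : ℕ) → SeqOfRecord F ϑ.ν ϑ.τ9.M (gB K) (pB K).K (pB K).K → SeqOfRecord F ϑ.ν ϑ.τ9.M (gA K) (pA K).K (pA K).K) (l₀ : ℝ) :
    ∀ (K : ℕ) (t : ℝ), |t| ≤ l₀ →
      T4GenFunBounds.schemeZ (D.scheme g₀) os (K₀ + K + 1) t =
        ∑ x ∈ (Finset.univ : Finset (SeqOfRecord F ϑ.ν ϑ.τ9.M (gA K) (pA K).K (pA K).K)).map (Function.Embedding.sigmaMk (β := fun K' => SeqOfRecord F ϑ.ν ϑ.τ9.M (gA K') (pA K').K (pA K').K) K),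
          ∑ s' ∈ Finset.univ.filter (fun s' : SeqOfRecord F ϑ.ν ϑ.τ9.M (gB x.1) (pB x.1).K (pB x.1).K => tr x.1 s' = x.2),
            classWeightOfDatum₉ F N ϑ D g₀ os (pB x.1) (gB x.1) (pB x.1).K t s' := by
  intro K t _
  rw [Finset.sum_map, ← hKB K]
  exact (sum_fiberwise_classWeightOfDatum₉_eq_schemeZ_of_ppSelLive ϑ E hsel (hgB K) (wOfRecord₉_nonneg ϑ hζ0 _ _) (wOfRecord₉_le_one ϑ hζ1 _ _)
    (fun k s' => measurable_wOfRecord_of_localBg hU ϑ.τ9.M ϑ.A₁ hζm _ _ k s') (fun k s => measurable_chiSeqOfRecord_of_localBg hU ϑ.τ9.M _ _ k s) hζu D hD os t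
    (pB K).K le_rfl Finset.univ (tr K) (fun s => Finset.mem_univ _)).symm

open Classical in
/-- **★ N19's :183 ROAD (∃δ-EDGE FORM) FOR CLASS-WEIGHT TERM DATA, E1 ∕ E2 DISCHARGED.**  At any datum `D` with measurable averaging, any Stage-9 tuple pinned at the live selector
(laws from the rows), runs `pA K` ∕ `pB K` at cutoffs `K₀ + K` ∕ `K₀ + K + 1` with histories starting at the dressing's coupling, and ANY truncation map `tr`: N20's `RelWeightBound`,
N21's `ShellWeightBound`, U4′'s `W + Wsh < 1` and N19's ∃δ-edge FOR THE TERM DATA READ OFF F3 (`A` = class weights, `B` = their fibre sums; shells ∕ bad sets ∕ weights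
abstract) ⇒ `∃ δ′, Summable δ′ ∧ MatchingModConstants vol l₀ δ′ (schemeZ (D.scheme g₀) os)` — module 1's `matching_scheme_of_coreEdge` with `hE1`∕`hE2` supplied by the two
previous lemmas. [cite: Balaban1985UV3, (6) p.257; Balaban1989LargeFieldII, (1.1)–(1.2) p.182; King1986, (3.10) p.656 (bookkeeping)] -/
theorem matching_scheme_of_coreEdge_classWeights (hsel : ϑ.ppSel = ppSelLiveOfRecord F N ϑ.ν ϑ.τ9 E (wOfRecord₉ F N ϑ))
    (hU : LocalBgMeasurable F N ϑ.ν) (hζm : ZetaMeasurable F N ϑ.ζ) (hζ0 : ∀ p g k s Pl Ql RS U V', 0 ≤ ϑ.ζ p g k s Pl Ql RS U V')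
    (hζ1 : IsZetaAbsLeOne F N ϑ.ν ϑ.τ9.M ϑ.ζ) (hζu : IsZetaUnity F N ϑ.ν ϑ.τ9.M ϑ.ζ)
    (D : FiniteEpsData F (SU N)) (hD : D.AvgMeasurable) (g₀ : ℕ → ℝ) (os : List (ULoop F)) {K₀ : ℕ} (pA pB : ℕ → B12.RunParams) (gA gB : ℕ → ℕ → ℝ)
    (hKA : ∀ K, (pA K).K = K₀ + K) (hKB : ∀ K, (pB K).K = K₀ + K + 1) (hgA : ∀ K, gA K 0 = g₀ (pA K).K) (hgB : ∀ K, gB K 0 = g₀ (pB K).K)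
    (tr : (K : ℕ) → SeqOfRecord F ϑ.ν ϑ.τ9.M (gB K) (pB K).K (pB K).K → SeqOfRecord F ϑ.ν ϑ.τ9.M (gA K) (pA K).K (pA K).K)
    {l₀ vol : ℝ} (hl₀ : 0 ≤ l₀) (hvol : 0 < vol)
    {shA shB : ℕ → ℝ → (Σ K, SeqOfRecord F ϑ.ν ϑ.τ9.M (gA K) (pA K).K (pA K).K) → ℝ}
    {Bad : ℕ → ℝ → Finset (Σ K, SeqOfRecord F ϑ.ν ϑ.τ9.M (gA K) (pA K).K (pA K).K)} {W Wsh : ℕ → ℝ}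
    (h20 : RelWeightBound l₀ (fun K => (Finset.univ : Finset (SeqOfRecord F ϑ.ν ϑ.τ9.M (gA K) (pA K).K (pA K).K)).map (Function.Embedding.sigmaMk (β := fun K' => SeqOfRecord F ϑ.ν ϑ.τ9.M (gA K') (pA K').K (pA K').K) K))
      (fun _ t x => classWeightOfDatum₉ F N ϑ D g₀ os (pA x.1) (gA x.1) (pA x.1).K t x.2)
      (fun _ t x => ∑ s' ∈ Finset.univ.filter (fun s' : SeqOfRecord F ϑ.ν ϑ.τ9.M (gB x.1) (pB x.1).K (pB x.1).K => tr x.1 s' = x.2),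
        classWeightOfDatum₉ F N ϑ D g₀ os (pB x.1) (gB x.1) (pB x.1).K t s') Bad W)
    (h21 : ShellWeightBound l₀ (fun K => (Finset.univ : Finset (SeqOfRecord F ϑ.ν ϑ.τ9.M (gA K) (pA K).K (pA K).K)).map (Function.Embedding.sigmaMk (β := fun K' => SeqOfRecord F ϑ.ν ϑ.τ9.M (gA K') (pA K').K (pA K').K) K))
      (fun _ t x => classWeightOfDatum₉ F N ϑ D g₀ os (pA x.1) (gA x.1) (pA x.1).K t x.2)
      (fun _ t x => ∑ s' ∈ Finset.univ.filter (fun s' : SeqOfRecord F ϑ.ν ϑ.τ9.M (gB x.1) (pB x.1).K (pB x.1).K => tr x.1 s' = x.2),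
        classWeightOfDatum₉ F N ϑ D g₀ os (pB x.1) (gB x.1) (pB x.1).K t s') shA shB Wsh)
    (hlt : ∀ K, W K + Wsh K < 1)
    (hedge : ∃ δ : ℕ → ℝ, NE7.Core l₀ vol
      (fun K => (Finset.univ : Finset (SeqOfRecord F ϑ.ν ϑ.τ9.M (gA K) (pA K).K (pA K).K)).map (Function.Embedding.sigmaMk (β := fun K' => SeqOfRecord F ϑ.ν ϑ.τ9.M (gA K') (pA K').K (pA K').K) K)) Bad
      (fun K t x => classWeightOfDatum₉ F N ϑ D g₀ os (pA x.1) (gA x.1) (pA x.1).K t x.2 - shA K t x)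
      (fun K t x => (∑ s' ∈ Finset.univ.filter (fun s' : SeqOfRecord F ϑ.ν ϑ.τ9.M (gB x.1) (pB x.1).K (pB x.1).K => tr x.1 s' = x.2),
        classWeightOfDatum₉ F N ϑ D g₀ os (pB x.1) (gB x.1) (pB x.1).K t s') - shB K t x) δ ∧ Summable δ) :
    ∃ δ' : ℕ → ℝ, Summable δ' ∧ MatchingModConstants vol l₀ δ' (T4GenFunBounds.schemeZ (D.scheme g₀) os) :=
  matching_scheme_of_coreEdge D hD g₀ os hl₀ hvol h20 h21 hlt hedge
    (schemeZ_eq_sum_classWeights_sigma ϑ E hsel hU hζm hζ0 hζ1 hζu D hD g₀ os pA gA hKA hgA l₀)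
    (schemeZ_succ_eq_sum_fiber_classWeights_sigma ϑ E hsel hU hζm hζ0 hζ1 hζu D hD g₀ os pA pB gA gB hKB hgB tr l₀)

end AnyDatum

/-! ## §2 At NODE 00's v1.7 datum of record `datumOfRecord₁₃CoPH F N θ h` (def-T FILE 27 p537939): rows `zetaAbs` ∕ `zetaUnity` and B1 BY NAME -/

section AtRecordCoPH

open Classical in
/-- **★ N19's :183 ROAD AT THE v1.7 DATUM OF RECORD FOR CLASS-WEIGHT TERM DATA, E1 ∕ E2 DISCHARGED** (`θ : Stage13HParams`, `h : θ.Provisos₁₃CoPH F N`; the dressed family run at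
`θ.toStage9Params`, started at the record's own datum; live-selector pin; displayed: `0 ≤ ζ`, (H-U), (H-ζ); rows `h.zetaAbs` ∕ `h.zetaUnity`, B1 `isPrintedAveraged_datumOfRecord₁₃CoPH`
BY NAME): module 23ᶜᵒᴾᴴ's `matching_datumOfRecord₁₃CoPH_of_coreEdge` with its `hE1` ∕ `hE2` no longer displayed. [cite: Balaban1985UV3, (6) p.257; Balaban1989LargeFieldII, Thm 1 + (0.1) pp.355–356; King1986, (3.10) p.656 (bookkeeping)] -/
theorem matching_datumOfRecord₁₃CoPH_of_coreEdge_classWeights (θ : Stage13HParams F N) (h : θ.Provisos₁₃CoPH F N) (E : B12.RunParams → ℝ)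
    (hsel : θ.ppSel = ppSelLiveOfRecord F N θ.ν θ.τ9 E (wOfRecord₉ F N θ.toStage9Params))
    (hU : LocalBgMeasurable F N θ.ν) (hζm : ZetaMeasurable F N θ.ζ) (hζ0 : ∀ p g k s Pl Ql RS U V', 0 ≤ θ.ζ p g k s Pl Ql RS U V')
    (g₀ : ℕ → ℝ) (os : List (ULoop F)) {K₀ : ℕ} (pA pB : ℕ → B12.RunParams) (gA gB : ℕ → ℕ → ℝ)
    (hKA : ∀ K, (pA K).K = K₀ + K) (hKB : ∀ K, (pB K).K = K₀ + K + 1) (hgA : ∀ K, gA K 0 = g₀ (pA K).K) (hgB : ∀ K, gB K 0 = g₀ (pB K).K)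
    (tr : (K : ℕ) → SeqOfRecord F θ.ν θ.τ9.M (gB K) (pB K).K (pB K).K → SeqOfRecord F θ.ν θ.τ9.M (gA K) (pA K).K (pA K).K)
    {l₀ vol : ℝ} (hl₀ : 0 ≤ l₀) (hvol : 0 < vol)
    {shA shB : ℕ → ℝ → (Σ K, SeqOfRecord F θ.ν θ.τ9.M (gA K) (pA K).K (pA K).K) → ℝ}
    {Bad : ℕ → ℝ → Finset (Σ K, SeqOfRecord F θ.ν θ.τ9.M (gA K) (pA K).K (pA K).K)} {W Wsh : ℕ → ℝ}
    (h20 : RelWeightBound l₀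
      (fun K => (Finset.univ : Finset (SeqOfRecord F θ.ν θ.τ9.M (gA K) (pA K).K (pA K).K)).map
        (Function.Embedding.sigmaMk (β := fun K' => SeqOfRecord F θ.ν θ.τ9.M (gA K') (pA K').K (pA K').K) K))
      (fun _ t x => classWeightOfDatum₉ F N θ.toStage9Params (datumOfRecord₁₃CoPH F N θ h) g₀ os (pA x.1) (gA x.1) (pA x.1).K t x.2)
      (fun _ t x => ∑ s' ∈ Finset.univ.filter (fun s' : SeqOfRecord F θ.ν θ.τ9.M (gB x.1) (pB x.1).K (pB x.1).K => tr x.1 s' = x.2),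
        classWeightOfDatum₉ F N θ.toStage9Params (datumOfRecord₁₃CoPH F N θ h) g₀ os (pB x.1) (gB x.1) (pB x.1).K t s') Bad W)
    (h21 : ShellWeightBound l₀
      (fun K => (Finset.univ : Finset (SeqOfRecord F θ.ν θ.τ9.M (gA K) (pA K).K (pA K).K)).map
        (Function.Embedding.sigmaMk (β := fun K' => SeqOfRecord F θ.ν θ.τ9.M (gA K') (pA K').K (pA K').K) K))
      (fun _ t x => classWeightOfDatum₉ F N θ.toStage9Params (datumOfRecord₁₃CoPH F N θ h) g₀ os (pA x.1) (gA x.1) (pA x.1).K t x.2)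
      (fun _ t x => ∑ s' ∈ Finset.univ.filter (fun s' : SeqOfRecord F θ.ν θ.τ9.M (gB x.1) (pB x.1).K (pB x.1).K => tr x.1 s' = x.2),
        classWeightOfDatum₉ F N θ.toStage9Params (datumOfRecord₁₃CoPH F N θ h) g₀ os (pB x.1) (gB x.1) (pB x.1).K t s') shA shB Wsh)
    (hlt : ∀ K, W K + Wsh K < 1)
    (hedge : ∃ δ : ℕ → ℝ, NE7.Core l₀ vol
      (fun K => (Finset.univ : Finset (SeqOfRecord F θ.ν θ.τ9.M (gA K) (pA K).K (pA K).K)).map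
        (Function.Embedding.sigmaMk (β := fun K' => SeqOfRecord F θ.ν θ.τ9.M (gA K') (pA K').K (pA K').K) K)) Bad
      (fun K t x => classWeightOfDatum₉ F N θ.toStage9Params (datumOfRecord₁₃CoPH F N θ h) g₀ os (pA x.1) (gA x.1) (pA x.1).K t x.2 - shA K t x)
      (fun K t x => (∑ s' ∈ Finset.univ.filter (fun s' : SeqOfRecord F θ.ν θ.τ9.M (gB x.1) (pB x.1).K (pB x.1).K => tr x.1 s' = x.2),
        classWeightOfDatum₉ F N θ.toStage9Params (datumOfRecord₁₃CoPH F N θ h) g₀ os (pB x.1) (gB x.1) (pB x.1).K t s') - shB K t x) δ ∧ Summable δ) :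
    ∃ δ' : ℕ → ℝ, Summable δ' ∧
      MatchingModConstants vol l₀ δ' (T4GenFunBounds.schemeZ ((datumOfRecord₁₃CoPH F N θ h).scheme g₀) os) :=
  matching_scheme_of_coreEdge_classWeights θ.toStage9Params E hsel hU hζm hζ0 h.zetaAbs h.zetaUnity (datumOfRecord₁₃CoPH F N θ h)
    (isPrintedAveraged_datumOfRecord₁₃CoPH F N θ h).avgMeasurable g₀ os pA pB gA gB hKA hKB hgA hgB tr hl₀ hvol h20 h21 hlt hedge

end AtRecordCoPH

end Summit.QuantumFields.YangMills.BalabanUVNodes.N19TargetClassWeightsE1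

end
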